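import Summits.AtomisticToContinuum.FouriersLaw.Theorems.VanishingNoiseTransferNoiseLocalityStubResponseDensityDetAux1
import Summits.AtomisticToContinuum.FouriersLaw.Theorems.OddSectorIrreversibilityCorrectorTheoryUniformMixing

/-!
# Stub `stub_responseDensityDet` of line `relative-flip-energy-transfer` (crux `VanishingNoiseTransfer.NoiseLocality`,
stmt-AtomisticToContinuum-11975): the deterministic linear-response density EXISTS — closed

Registered stub 1a of the lead skeleton `Cruxes/NoiseLocality/Lines/relative_flip_energy_transfer.lean`: for the
unique weak steady family `μ` of the `N`-site pinned anharmonic chain between Langevin baths and every `T > 0` there is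
`U ∈ L²(μ_T)` (`μ_T = gibbsMeasure N T`) with `d/dδ ∫ g dμ_{T+δ/2,T−δ/2}|₀ = ∫ g U dμ_T` for every `g ∈ C_c^∞` AND
`d/dδ totalCurrent(μ_{T+δ/2,T−δ/2})|₀ = Σ_i ∫ j_i U dμ_T`.

It is now a COROLLARY of two theorems that landed in the tree during this line's first wave:
`Theses.VanishingNoiseTransfer.NessUnique_holds` (item stmt-0741, uniqueness of weak steady states) and
`Theorems.OddSectorIrreversibility.Corrector.responseDensity_holds` (item stmt-9144, Hairer–Majda-type linear response of
the hypoelliptic NESS from uniform mixing), through the conditional form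
`StubResponseDensityDet.of_nessUnique_of_responseDensity` landed by this line's stub worker (Aux1: the `N ≤ 1` lengths by
hand, `N ≥ 2` by identifying the per-`N` unique family with a global reference family and converting the item's
difference quotients along `𝓝[≠] 0` into `HasDerivAt` at `0`).

References: M. Hairer, A. J. Majda, *A simple framework to justify linear response theory*, Nonlinearity 23 (2010)
909–922 (arXiv:0909.4313), Thm 2.3; N. Cuneo, J.-P. Eckmann, M. Hairer, L. Rey-Bellet, EJP 23 (2018) no. 55, Thm 2.13.
-/

namespace Summit.AtomisticToContinuum.FouriersLaw.Theorems.NoiseLocality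

/-- **Registered stub `stub_responseDensityDet` (line `relative-flip-energy-transfer`, crux NoiseLocality), PROVED.**
For `pinnedChain ω₂ lam β γ` (all parameters `> 0`), `T > 0`, every length `N` and the unique weak steady family `μ`
(steady at all `T_L, T_R > 0`, unique in the class `IsSteadyState`): there is a linear-response density
`U ∈ L²(gibbsMeasure N T)` representing the `δ`-derivative at `0` of `δ ↦ ∫ g dμ_{T+δ/2,T−δ/2}` for all smooth compactly
supported `g` and of `δ ↦ totalCurrent μ_{T+δ/2,T−δ/2}`. Corollary of `NessUnique_holds` (stmt-0741) and
`responseDensity_holds` (stmt-9144) via `StubResponseDensityDet.of_nessUnique_of_responseDensity`.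
[cite: HairerMajda2009, Thm 2.3] [cite: CuneoEckmannHairerReyBellet2018, Thm 2.13] -/
theorem stub_responseDensityDet :
    ∀ ω₂ lam β γ : ℝ, 0 < ω₂ → 0 < lam → 0 < β → 0 < γ → ∀ T : ℝ, 0 < T → ∀ (N : ℕ)
    (μ : ℝ → ℝ → MeasureTheory.Measure (Literature.MathematicalPhysics.KineticTheory.HeatConduction.PhaseSpace N)),
    (∀ T_L T_R : ℝ, 0 < T_L → 0 < T_R →
      (Literature.MathematicalPhysics.KineticTheory.HeatConduction.pinnedChain ω₂ lam β γ).IsSteadyState N T_L T_R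
          (μ T_L T_R) ∧
        ∀ ν : MeasureTheory.Measure (Literature.MathematicalPhysics.KineticTheory.HeatConduction.PhaseSpace N),
          (Literature.MathematicalPhysics.KineticTheory.HeatConduction.pinnedChain ω₂ lam β γ).IsSteadyState N T_L T_R ν →
            ν = μ T_L T_R) →
    ∃ U : Literature.MathematicalPhysics.KineticTheory.HeatConduction.PhaseSpace N → ℝ,
      MeasureTheory.MemLp U 2
          ((Literature.MathematicalPhysics.KineticTheory.HeatConduction.pinnedChain ω₂ lam β γ).gibbsMeasure N T) ∧
        (∀ g : Literature.MathematicalPhysics.KineticTheory.HeatConduction.PhaseSpace N → ℝ,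
          ContDiff ℝ ((⊤ : ℕ∞) : WithTop ℕ∞) g → HasCompactSupport g →
            HasDerivAt (fun δ : ℝ => ∫ x, g x ∂(μ (T + δ / 2) (T - δ / 2)))
              (∫ x, g x * U x
                ∂((Literature.MathematicalPhysics.KineticTheory.HeatConduction.pinnedChain ω₂ lam β γ).gibbsMeasure N T))
              0) ∧
        HasDerivAt (fun δ : ℝ =>
            (Literature.MathematicalPhysics.KineticTheory.HeatConduction.pinnedChain ω₂ lam β γ).totalCurrent
              (μ (T + δ / 2) (T - δ / 2)))
          (∑ i : Fin N, ∫ x,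
            (Literature.MathematicalPhysics.KineticTheory.HeatConduction.pinnedChain ω₂ lam β γ).bondCurrent N i x * U x
              ∂((Literature.MathematicalPhysics.KineticTheory.HeatConduction.pinnedChain ω₂ lam β γ).gibbsMeasure N T))
          0  :=
  StubResponseDensityDet.of_nessUnique_of_responseDensity
    Summit.AtomisticToContinuum.FouriersLaw.Theses.VanishingNoiseTransfer.NessUnique_holds
    Summit.AtomisticToContinuum.FouriersLaw.Theorems.OddSectorIrreversibility.Corrector.responseDensity_holds

end Summit.AtomisticToContinuum.FouriersLaw.Theorems.NoiseLocality
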